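import Summits.QuantumFields.YangMills.Theorems.BalabanUVNodesN15KingModelPauliLinksDecay
import Summits.QuantumFields.YangMills.Theorems.BalabanUVNodesN15KingModelConstantLinkCommonEigenvector
import Summits.QuantumFields.YangMills.Theorems.BalabanUVNodesN15KingModelPauliTriple
import HarnessLib

/-!
# BalabanUVNodes ∕ N15 — THE KING-MODEL RUNG (PART Ϸ-k): THE NON-ABELIAN CONSTANT-CURVATURE PACKAGE — PART Ϸ by name in two conjunctions: `king_pauli_package` (the lattice statements on
# every torus) and `king_nonabelian_what_the_curved_case_adds` (flat ∕ abelian-like constant links carry NO mass; the non-commuting Pauli pair carries an η-UNIFORM mass `→ min(α²,β²)`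
# with η-uniform decay, while the plaquette road's mass `→ 0`) (Track A, DAG node N15 = NE2; FAN-OUT v1.1 §N15 s3 «KING-MODEL RUNG … + the one-line statement of what the curved case adds»;
# count-neutral)

HONEST FRAMING.  Count-neutral (cell `pub-ymgap`, seat `pub-ymgap-dag-n15-e` g48; `--supports stmt-QuantumFields-27247 --as helper` = K3ᴬ, KEY MAP v3).  Conjunctions of PART Ϸ-a…Ϸ-j BY
NAME; King's fine covariance layer `−cΔ_U + m²` (Ͱ-a `covLapF`; [Balaban1985BackgroundPropagators] (3.23) p.394, [King1986] (4.4) p.670) at CONSTANT link fields on ONE finite torus per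
spacing; NOT Bałaban's `G_k(U)` (no block term), NOT (3.42); NOT a node discharge (N15 of record untouched); nothing continuum-YM ∕ ℝ⁴ ∕ OS ∕ mass gap ∕ Clay.

THE ONE-LINE STATEMENT OF WHAT THE (NON-ABELIAN) CURVED CASE ADDS.  At `U ≡ 1` — and at ANY constant links with a common fixed vector — the massless fine operator has a zero mode
(no mass, PART Ϸ-h); at the constant non-commuting pair `e^{iaσ₁}, e^{ibσ₂}` it is positive definite on EVERY torus with `‖(−cΔ_W)⁻¹‖ ≤ (c·min(sin²a,sin²b))⁻¹` and exponentially decaying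
kernel (PARTS Ϸ-d∕Ϸ-g), the bound being asymptotically exact (Ϸ-e) and, in King's units, an η-UNIFORM mass `→ min(α²,β²) = ½·|F|·(min∕max)` — linear in the curvature — where the
plaquette road of PART Ϳ sees only `O(η²)` (Ϸ-f).

THE RESULTS: ★★★ **`king_pauli_package`** (8 conjuncts: Ϸ-d gap ∕ posDef ∕ `‖G‖`, Ϸ-g decay, Ϸ-e exact eigenvalue, Ϸ-d vs Ϳ roads, Ϸ-i triple, Ϸ-h cap), ★★★
**`king_nonabelian_what_the_curved_case_adds`** (flat zero mode ∧ common-fixed-vector zero mode ∧ Pauli posDef with covariance bound ∧ the three continuum limits `min(α²,β²)`, `2αβ`, `0`).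
PRIOR TREE ART (by name): Ϸ-d (`re_quadForm_covLapF_pauliLink_ge`, `posDef_covLapF_pauliLink_massless`, `l2_opNorm_covLapF_pauliLink_massless_inv_le`, `pauli_plaq_road_le`), Ϸ-e
(`exists_eigenvalue_covLapF_pauliLink_eq`), Ϸ-f (`tendsto_pauliScaled`, `tendsto_pauliCurvScaled`, `tendsto_pauli_plaq_road_scaled`), Ϸ-g (`norm_covLapF_pauliLink_massless_inv_entry_le`), Ϸ-h
(`not_posDef_massless_of_common_fixed_vector`, `exists_eigenvalue_le_of_common_eigenvector`), Ϸ-i (`re_quadForm_covLapF_pauliTriple_ge`).  Dedup (rg at filing): basename 0 files; needles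
`king_pauli_package|king_nonabelian_what_the_curved_case_adds` 0 tree files.  Locators: [King1986] (2.12) p.653, (4.4) p.670, (4.35) p.674, Lemma 4.5 (4.38) p.674; [Balaban1985BackgroundPropagators]
(3.3) p.391, (3.23) p.394, (3.39) p.397; [DodziukMathai2006] §1 Cor 1.3.  0 `sorry`, 0 `def`.
-/

noncomputable section

open scoped BigOperators ComplexConjugate ComplexOrder InnerProductSpace Topology Matrix.Norms.L2Operator
open Finset Matrix WithLp Filter

namespace Summit.QuantumFields.YangMills.BalabanUVNodes.N15KingModelRung.ConstantCurvature

open Literature.MathematicalPhysics.QuantumFieldTheory.Balaban1983to89.B5Prop11Plancherel (Tor unitVec chi sOf)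
open Literature.MathematicalPhysics.QuantumFieldTheory.King1986.Torus (tdistT)
open Summit.QuantumFields.YangMills.BalabanUVNodes.N15KingModelRung.Covariant (covLapF fib isHermitian_covLapF)
open Summit.QuantumFields.YangMills.BalabanUVNodes.N15KingModelRung.Curvature (plaqGap)

variable {d : ℕ} (K : Fin (d + 1) → ℕ) [hK : ∀ μ, NeZero (K μ)]

/-- ★★★ **THE PAULI PACKAGE** (`c > 0`, `sin a·sin b ≠ 0`, `ν₀,ν₁,ν₂` pairwise distinct; every torus `K`): (1) the gap `(m² + c·min(sin²a,sin²b))Σ‖v_x‖² ≤ Re⟨v,(−cΔ_W+m²)v⟩`;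
(2) the massless `−cΔ_W ≻ 0`; (3) `‖(−cΔ_W)⁻¹‖ ≤ (c·min)⁻¹`; (4) its kernel decays `≤ (2∕(ct))e^{−√(t∕(16(d+1)))d(x,y)}`; (5) at a momentum supported on `ν₀` with lattice angle `q′`
the value `m² + 2c(1−cos b)` IS an eigenvalue of the pair `(e^{iq′σ₁}, e^{ibσ₂})`; (6) PART Ϳ's plaquette constant `≤ 2c sin²a sin²b`; (7) the triple's gap `m² + c(S − M)`; (8) a common
eigenvector of ANY constant links caps the spectrum by the abelian form of its eigenphases. [cite: King1986, (4.4) p.670, (4.35) p.674, (2.12) p.653; Balaban1985BackgroundPropagators, (3.23) p.394, (3.39) p.397; DodziukMathai2006, Cor 1.3 §1] -/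
theorem king_pauli_package {c : ℝ} (hc : 0 < c) (m2 : ℝ) {a b e : ℝ} (ha : Real.sin a ≠ 0) (hb : Real.sin b ≠ 0) {ν₀ ν₁ ν₂ : Fin (d + 1)} (h01 : ν₀ ≠ ν₁) (h02 : ν₀ ≠ ν₂) (h12 : ν₁ ≠ ν₂) :
    (∀ v : Tor K × Fin 2 → ℂ, (m2 + c * min (Real.sin a ^ 2) (Real.sin b ^ 2)) * ∑ x, ‖fib K v x‖ ^ 2
        ≤ RCLike.re (star v ⬝ᵥ (covLapF K c m2 (kingConstLink K (pauliLink a b ν₀ ν₁)) *ᵥ v)))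
    ∧ (covLapF K c 0 (kingConstLink K (pauliLink a b ν₀ ν₁))).PosDef
    ∧ ‖(covLapF K c 0 (kingConstLink K (pauliLink a b ν₀ ν₁)))⁻¹‖ ≤ (c * min (Real.sin a ^ 2) (Real.sin b ^ 2))⁻¹
    ∧ (∀ (x y : Tor K) (i j : Fin 2), ‖(covLapF K c 0 (kingConstLink K (pauliLink (d := d) a b ν₀ ν₁)))⁻¹ (x, i) (y, j)‖
        ≤ 2 / (c * min (Real.sin a ^ 2) (Real.sin b ^ 2)) * Real.exp (-(Real.sqrt (min (Real.sin a ^ 2) (Real.sin b ^ 2) / (16 * ((d : ℝ) + 1))) * tdistT K x y)))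
    ∧ (∀ q : Tor K, (∀ μ, μ ≠ ν₀ → q μ = 0) →
        ∃ i, (isHermitian_covLapF K c m2 (kingConstLink K (pauliLink (d := d) (sOf K q ν₀) b ν₀ ν₁))).eigenvalues i = m2 + 2 * c * (1 - Real.cos b))
    ∧ 2 * c * plaqGap (1 - 2 * (Real.sin a) ^ 2 * (Real.sin b) ^ 2) ≤ 2 * c * ((Real.sin a) ^ 2 * (Real.sin b) ^ 2)
    ∧ (∀ v : Tor K × Fin 2 → ℂ, (m2 + c * (Real.sin a ^ 2 + Real.sin b ^ 2 + Real.sin e ^ 2 - max (Real.sin a ^ 2) (max (Real.sin b ^ 2) (Real.sin e ^ 2)))) * ∑ x, ‖fib K v x‖ ^ 2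
        ≤ RCLike.re (star v ⬝ᵥ (covLapF K c m2 (kingConstLink K (pauliTriple a b e ν₀ ν₁ ν₂)) *ᵥ v)))
    ∧ (∀ {n : Type} [Fintype n] [DecidableEq n] (W : Fin (d + 1) → Matrix n n ℂ), (∀ μ, W μ ∈ Matrix.unitaryGroup n ℂ) →
        ∀ (ζ : n → ℂ), ζ ≠ 0 → ∀ lam : Fin (d + 1) → ℂ, (∀ μ, W μ *ᵥ ζ = lam μ • ζ) → ∀ q : Tor K,
          ∃ i, (isHermitian_covLapF K c m2 (kingConstLink K W)).eigenvalues i ≤ m2 + c * ∑ μ, ‖1 - chi K q (unitVec K μ) * lam μ‖ ^ 2) :=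
  ⟨fun v => re_quadForm_covLapF_pauliLink_ge K hc.le m2 a b h01 v,
   posDef_covLapF_pauliLink_massless K hc ha hb h01,
   l2_opNorm_covLapF_pauliLink_massless_inv_le K hc ha hb h01,
   fun x y i j => norm_covLapF_pauliLink_massless_inv_entry_le K hc ha hb h01 x y i j,
   fun q hq => exists_eigenvalue_covLapF_pauliLink_eq K c m2 b h01 q hq,
   pauli_plaq_road_le hc.le a b,
   fun v => re_quadForm_covLapF_pauliTriple_ge K hc.le m2 a b e h01 h02 h12 v,
   fun _ hW _ hζ _ heig q => exists_eigenvalue_le_of_common_eigenvector K hW hζ heig c m2 q⟩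

/-- ★★★ **WHAT THE NON-ABELIAN CURVED CASE ADDS** (`c > 0`, `ν₀ ≠ ν₁`): (i) FLAT: at `W ≡ 1` the massless fine operator is NOT positive definite (the constants are zero modes);
(ii) ABELIAN-LIKE: at ANY constant unitary links with a common FIXED vector it is NOT positive definite either; (iii) NON-COMMUTING: at the Pauli pair with `sin a·sin b ≠ 0` it IS positive
definite on every torus with `‖(−cΔ_W)⁻¹‖ ≤ (c·min(sin²a,sin²b))⁻¹`; (iv) IN KING's UNITS (`c = η⁻²`, `a = αη`, `b = βη`, `α,β ≥ 0`): the mass floor `→ min(α²,β²)`, the curvature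
`→ 2αβ`, and PART Ϳ's plaquette mass `→ 0` as `η → 0⁺` — the curved constant background carries an η-UNIFORM mass, LINEAR in the curvature at fixed anisotropy.
[cite: King1986, (4.4) p.670, Lemma 4.5 (4.38) p.674, (2.12) p.653; Balaban1985BackgroundPropagators, (3.23) p.394, (3.39) p.397; DodziukMathai2006, Cor 1.3 §1] -/
theorem king_nonabelian_what_the_curved_case_adds {c : ℝ} (hc : 0 < c) {ν₀ ν₁ : Fin (d + 1)} (hν : ν₀ ≠ ν₁) :
    (¬ (covLapF K c 0 (kingConstLink K (fun _ : Fin (d + 1) => (1 : Matrix (Fin 2) (Fin 2) ℂ)))).PosDef)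
    ∧ (∀ {n : Type} [Fintype n] [DecidableEq n] (W : Fin (d + 1) → Matrix n n ℂ), (∀ μ, W μ ∈ Matrix.unitaryGroup n ℂ) →
        ∀ ζ : n → ℂ, ζ ≠ 0 → (∀ μ, W μ *ᵥ ζ = ζ) → ¬ (covLapF K c 0 (kingConstLink K W)).PosDef)
    ∧ (∀ {a b : ℝ}, Real.sin a ≠ 0 → Real.sin b ≠ 0 →
        (covLapF K c 0 (kingConstLink K (pauliLink a b ν₀ ν₁))).PosDef
        ∧ ‖(covLapF K c 0 (kingConstLink K (pauliLink a b ν₀ ν₁)))⁻¹‖ ≤ (c * min (Real.sin a ^ 2) (Real.sin b ^ 2))⁻¹)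
    ∧ (∀ {α β : ℝ}, 0 ≤ α → 0 ≤ β →
        Tendsto (fun η : ℝ => pauliScaled α β η) (𝓝[>] 0) (𝓝 (min (α ^ 2) (β ^ 2)))
        ∧ Tendsto (fun η : ℝ => pauliCurvScaled α β η) (𝓝[>] 0) (𝓝 (2 * α * β))
        ∧ Tendsto (fun η : ℝ => 2 * η⁻¹ ^ 2 * plaqGap (1 - 2 * Real.sin (α * η) ^ 2 * Real.sin (β * η) ^ 2)) (𝓝[>] 0) (𝓝 0)) := by
  refine ⟨?_, fun W hW ζ hζ hfix => not_posDef_massless_of_common_fixed_vector K hW hζ hfix c, fun ha hb => ⟨posDef_covLapF_pauliLink_massless K hc ha hb hν,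
    l2_opNorm_covLapF_pauliLink_massless_inv_le K hc ha hb hν⟩, fun hα hβ => ⟨tendsto_pauliScaled hα hβ, tendsto_pauliCurvScaled hα hβ, tendsto_pauli_plaq_road_scaled _ _⟩⟩
  -- the flat field fixes `(1,0)`
  refine not_posDef_massless_of_common_fixed_vector K (fun _ => Submonoid.one_mem _) (ζ := ![1, 0]) (fun h => by simpa using congr_fun h 0) (fun μ => Matrix.one_mulVec _) c

end Summit.QuantumFields.YangMills.BalabanUVNodes.N15KingModelRung.ConstantCurvature

end
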